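import Summits.Ventures.CertifiedManyBodySolver.Downfold.EmeryAntibondingBand
import HarnessLib

/-!
# The filling ↦ Fermi-energy map of the σ three-band antibonding band, I: the occupied Brillouin-zone
# fraction `abFilling` and the momentum grid

Venture CertifiedManyBodySolver, cell `pub/hubbard-downfold` (stage S1, HUMAN RULINGS D-0096/D-0098: the
three-band → one-band reduction error is carried explicitly), seat hubbard-downfold-mod-4 (technique B = band
level); namespace `Summit.Ventures.CertifiedManyBodySolver.Downfold.Emery`. Everything here is PROVED.
WHAT THIS IS NOT: a statement about any material (no literature number lives here); not a many-body
statement (`U = 0` band filling of the σ model `bloch4`); the BZ fraction is Lebesgue measure, no k-mesh.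

`EmeryFermiSurfaceShapeBox.fsRatio_mem_Icc` turns a three-band parameter box AND a Fermi-energy bracket
`[ε₁, ε₂]` into a certified interval for the object-E coordinate `t′/t`; its docstring leaves the bracket as
an INPUT («the filling ↦ ε_F map is not closed-form and is supplied by the consumer»). This series
(`EmeryFermiFilling`, `EmeryFermiFillingCount`, `EmeryFermiSurfaceRatioWindow`) closes that input:

* §1 `abFilling Δ t_pd t_pp t_pp′ ε` — the fraction of the quadrant `[0, π]²` (= of the Brillouin zone, by the
  `k ↦ −k` symmetries of `bloch4`) on which the antibonding band `abBand` (`EmeryAntibondingBand`) lies at or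
  below `ε`, as a Lebesgue measure; PER SPIN, so the one-band electron density is `n = 2·abFilling(ε_F)` and
  `n_holes = 1 + x` per CuO₂ ⇔ `abFilling(ε_F) = (1 − x)/2`. Monotone in `ε` (`abFilling_mono`).
* §2 the grid `k_i = iπ/K`, half-open / closed cells `cellIco` / `cellIcc`, their Lebesgue measure `(π/K)²`,
  disjointness, the cell index of a point (`exists_gridIndex`), and the half-angle variable
  `halfSq k = sin²(k/2)` (monotone on `[0, π]`, `halfSq_mono`).

The counting theorems (grid certificate ⇒ two-sided bounds on `abFilling`) are in `EmeryFermiFillingCount`.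
Sources: three-band model [HybertsenSchluterChristensen1989, Eq. (1)]; contour language [AndersenEtAl1995, §6].
-/

noncomputable section

namespace Summit.Ventures.CertifiedManyBodySolver.Downfold.Emery

open Real MeasureTheory Set
/-! ## §1 The antibonding-band filling at energy `ε` -/

/-- The half-angle variable `x(k) = sin²(k/2)` of `EmeryFermiSurfaceShape`. [cite: AndersenEtAl1995, §6] -/
def halfSq (k : ℝ) : ℝ := Real.sin (k / 2) ^ 2

/-- `sin²(k/2) = (1 − cos k)/2`. [folklore] -/
theorem halfSq_eq_cos (k : ℝ) : halfSq k = (1 - Real.cos k) / 2 := by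
  unfold halfSq
  rw [Literature.Probability.LatticeModels.cos_eq_one_sub_two_mul_sin_half_sq k]
  ring

/-- `0 ≤ sin²(k/2)`. [folklore] -/
theorem halfSq_nonneg (k : ℝ) : 0 ≤ halfSq k := by unfold halfSq; positivity

/-- `sin²(k/2) ≤ 1`. [folklore] -/
theorem halfSq_le_one (k : ℝ) : halfSq k ≤ 1 := by
  rw [halfSq_eq_cos]; have := Real.neg_one_le_cos k; linarith

/-- `x(k) = sin²(k/2)` is monotone on `[0, π]` (the cosine is antitone there). [folklore] -/
theorem halfSq_mono {a b : ℝ} (ha : 0 ≤ a) (hab : a ≤ b) (hb : b ≤ π) : halfSq a ≤ halfSq b := by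
  rw [halfSq_eq_cos, halfSq_eq_cos]
  have := Real.cos_le_cos_of_nonneg_of_le_pi ha hb hab
  linarith

/-- The OCCUPIED SET of the antibonding band at Fermi energy `ε`, in the quadrant `[0, π]²` of the Brillouin
zone: the momenta `k` with `ε_AB(k) ≤ ε` (`abBand` at `x = sin²(kx/2)`, `y = sin²(ky/2)`).
[cite: HybertsenSchluterChristensen1989, Eq. (1) (three-band d–p model)] -/
def abOccSet (Δ tpd tpp c ε : ℝ) : Set (ℝ × ℝ) :=
  {k | k ∈ Icc (0 : ℝ) π ×ˢ Icc (0 : ℝ) π ∧ abBand Δ tpd tpp c (halfSq k.1) (halfSq k.2) ≤ ε}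

/-- THE FILLING of the antibonding band at Fermi energy `ε`, PER SPIN: the Lebesgue fraction of the quadrant
`[0, π]²` occupied (`= n/2` with `n` the one-band electron density; `n_holes = 1 + x` per CuO₂ ⇔ value
`(1 − x)/2`). [cite: HybertsenSchluterChristensen1989, Eq. (1) (three-band d–p model)] -/
def abFilling (Δ tpd tpp c ε : ℝ) : ℝ := (volume (abOccSet Δ tpd tpp c ε)).toReal / π ^ 2

/-- The occupied set sits in the quadrant. [folklore] -/
theorem abOccSet_subset_quadrant (Δ tpd tpp c ε : ℝ) :
    abOccSet Δ tpd tpp c ε ⊆ Icc (0 : ℝ) π ×ˢ Icc (0 : ℝ) π := fun _ hk => hk.1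

/-- Lebesgue measure of a product of closed intervals in `ℝ × ℝ`. [folklore] -/
theorem volume_Icc_prod_Icc (a b a' b' : ℝ) :
    volume (Icc a b ×ˢ Icc a' b') = ENNReal.ofReal (b - a) * ENNReal.ofReal (b' - a') := by
  rw [Measure.volume_eq_prod, Measure.prod_prod, Real.volume_Icc, Real.volume_Icc]

/-- Lebesgue measure of a product of half-open intervals in `ℝ × ℝ`. [folklore] -/
theorem volume_Ico_prod_Ico (a b a' b' : ℝ) :
    volume (Ico a b ×ˢ Ico a' b') = ENNReal.ofReal (b - a) * ENNReal.ofReal (b' - a') := by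
  rw [Measure.volume_eq_prod, Measure.prod_prod, Real.volume_Ico, Real.volume_Ico]

/-- The occupied set has finite measure (at most `π²`). [folklore] -/
theorem volume_abOccSet_le (Δ tpd tpp c ε : ℝ) :
    volume (abOccSet Δ tpd tpp c ε) ≤ ENNReal.ofReal (π - 0) * ENNReal.ofReal (π - 0) := by
  rw [← volume_Icc_prod_Icc]
  exact measure_mono (abOccSet_subset_quadrant Δ tpd tpp c ε)

/-- [folklore] -/
theorem volume_abOccSet_ne_top (Δ tpd tpp c ε : ℝ) : volume (abOccSet Δ tpd tpp c ε) ≠ ⊤ :=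
  ne_top_of_le_ne_top (ENNReal.mul_ne_top ENNReal.ofReal_ne_top ENNReal.ofReal_ne_top)
    (volume_abOccSet_le Δ tpd tpp c ε)

/-- THE FILLING IS MONOTONE IN THE FERMI ENERGY. [folklore] -/
theorem abFilling_mono (Δ tpd tpp c : ℝ) {ε₁ ε₂ : ℝ} (h : ε₁ ≤ ε₂) :
    abFilling Δ tpd tpp c ε₁ ≤ abFilling Δ tpd tpp c ε₂ := by
  unfold abFilling
  refine div_le_div_of_nonneg_right ?_ (by positivity)
  refine ENNReal.toReal_mono (volume_abOccSet_ne_top Δ tpd tpp c ε₂) (measure_mono ?_)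
  intro k hk
  exact ⟨hk.1, hk.2.trans h⟩

/-- `0 ≤ abFilling`. [folklore] -/
theorem abFilling_nonneg (Δ tpd tpp c ε : ℝ) : 0 ≤ abFilling Δ tpd tpp c ε := by
  unfold abFilling; positivity

/-! ## §2 The grid `k_i = iπ/K`, its cells and their measure -/

/-- Grid point `k_i = iπ/K`. [folklore] -/
def gridPt (K i : ℕ) : ℝ := (i : ℝ) * π / K

/-- [folklore] -/
theorem gridPt_zero (K : ℕ) : gridPt K 0 = 0 := by simp [gridPt]

/-- [folklore] -/
theorem gridPt_self {K : ℕ} (hK : 0 < K) : gridPt K K = π := by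
  unfold gridPt; field_simp

/-- [folklore] -/
theorem gridPt_nonneg (K i : ℕ) : 0 ≤ gridPt K i := by unfold gridPt; positivity

/-- [folklore] -/
theorem gridPt_mono (K : ℕ) {i j : ℕ} (h : i ≤ j) : gridPt K i ≤ gridPt K j := by
  unfold gridPt
  rcases Nat.eq_zero_or_pos K with hK | hK
  · subst hK; simp
  · have : (i : ℝ) ≤ j := by exact_mod_cast h
    have hπ := Real.pi_pos
    exact div_le_div_of_nonneg_right (by nlinarith) (by positivity)

/-- [folklore] -/
theorem gridPt_le_pi {K i : ℕ} (hK : 0 < K) (h : i ≤ K) : gridPt K i ≤ π := by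
  calc gridPt K i ≤ gridPt K K := gridPt_mono K h
    _ = π := gridPt_self hK

/-- Consecutive grid points differ by `π/K`. [folklore] -/
theorem gridPt_succ_sub {K : ℕ} (hK : 0 < K) (i : ℕ) : gridPt K (i + 1) - gridPt K i = π / K := by
  unfold gridPt
  have hK' : (K : ℝ) ≠ 0 := by exact_mod_cast hK.ne'
  field_simp
  push_cast
  ring

/-- Half-open grid cell `[k_i, k_{i+1}) × [k_j, k_{j+1})`. [folklore] -/
def cellIco (K : ℕ) (ij : ℕ × ℕ) : Set (ℝ × ℝ) :=
  Ico (gridPt K ij.1) (gridPt K (ij.1 + 1)) ×ˢ Ico (gridPt K ij.2) (gridPt K (ij.2 + 1))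

/-- Closed grid cell `[k_i, k_{i+1}] × [k_j, k_{j+1}]`. [folklore] -/
def cellIcc (K : ℕ) (ij : ℕ × ℕ) : Set (ℝ × ℝ) :=
  Icc (gridPt K ij.1) (gridPt K (ij.1 + 1)) ×ˢ Icc (gridPt K ij.2) (gridPt K (ij.2 + 1))

/-- Measure of a half-open cell: `(π/K)²`. [folklore] -/
theorem volume_cellIco {K : ℕ} (hK : 0 < K) (ij : ℕ × ℕ) :
    volume (cellIco K ij) = ENNReal.ofReal (π / K) * ENNReal.ofReal (π / K) := by
  unfold cellIco
  rw [volume_Ico_prod_Ico, gridPt_succ_sub hK, gridPt_succ_sub hK]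

/-- Measure of a closed cell: `(π/K)²`. [folklore] -/
theorem volume_cellIcc {K : ℕ} (hK : 0 < K) (ij : ℕ × ℕ) :
    volume (cellIcc K ij) = ENNReal.ofReal (π / K) * ENNReal.ofReal (π / K) := by
  unfold cellIcc
  rw [volume_Icc_prod_Icc, gridPt_succ_sub hK, gridPt_succ_sub hK]

/-- The half-open cells are measurable. [folklore] -/
theorem measurableSet_cellIco (K : ℕ) (ij : ℕ × ℕ) : MeasurableSet (cellIco K ij) :=
  measurableSet_Ico.prod measurableSet_Ico

/-- Distinct half-open cells are disjoint. [folklore] -/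
theorem cellIco_disjoint (K : ℕ) {ij ij' : ℕ × ℕ} (h : ij ≠ ij') :
    Disjoint (cellIco K ij) (cellIco K ij') := by
  rw [Set.disjoint_left]
  rintro ⟨k1, k2⟩ ⟨⟨ha1, ha2⟩, ⟨hb1, hb2⟩⟩ ⟨⟨ha1', ha2'⟩, ⟨hb1', hb2'⟩⟩
  apply h
  have key : ∀ {i i' : ℕ} {t : ℝ}, gridPt K i ≤ t → t < gridPt K (i + 1) → gridPt K i' ≤ t →
      t < gridPt K (i' + 1) → i = i' := by
    intro i i' t h1 h2 h3 h4
    by_contra hne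
    rcases Nat.lt_or_gt_of_ne hne with hlt | hlt
    · have := gridPt_mono K (Nat.succ_le_of_lt hlt); linarith
    · have := gridPt_mono K (Nat.succ_le_of_lt hlt); linarith
  exact Prod.ext (key ha1 ha2 ha1' ha2') (key hb1 hb2 hb1' hb2')

/-- Every point of `[0, π]` lies in some closed grid interval `[k_i, k_{i+1}]`, `i < K`. [folklore] -/
theorem exists_gridIndex {K : ℕ} (hK : 0 < K) {t : ℝ} (h0 : 0 ≤ t) (hπ : t ≤ π) :
    ∃ i, i < K ∧ gridPt K i ≤ t ∧ t ≤ gridPt K (i + 1) := by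
  have hKr : (0 : ℝ) < K := by exact_mod_cast hK
  have hπpos := Real.pi_pos
  -- the scaled coordinate `s = tK/π ∈ [0, K]`
  set s : ℝ := t * K / π with hs
  have hs0 : 0 ≤ s := by rw [hs]; positivity
  have hsK : s ≤ K := by
    rw [hs, div_le_iff₀ hπpos]
    nlinarith
  have hts : t = s * π / K := by rw [hs]; field_simp
  rcases lt_or_ge s K with hlt | hge
  · refine ⟨⌊s⌋₊, ?_, ?_, ?_⟩
    · exact (Nat.floor_lt hs0).2 hlt
    · rw [hts]; unfold gridPt
      exact div_le_div_of_nonneg_right (mul_le_mul_of_nonneg_right (Nat.floor_le hs0) hπpos.le)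
        hKr.le
    · rw [hts]; unfold gridPt
      refine div_le_div_of_nonneg_right (mul_le_mul_of_nonneg_right ?_ hπpos.le) hKr.le
      push_cast
      exact (Nat.lt_floor_add_one s).le
  · refine ⟨K - 1, Nat.sub_lt hK Nat.one_pos, ?_, ?_⟩
    · calc gridPt K (K - 1) ≤ gridPt K K := gridPt_mono K (Nat.sub_le K 1)
        _ = π := gridPt_self hK
        _ = s * π / K := by
            have : s = K := le_antisymm hsK hge
            rw [this]; field_simp
        _ = t := hts.symm
    · rw [Nat.sub_add_cancel hK, gridPt_self hK]; exact hπ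

end Summit.Ventures.CertifiedManyBodySolver.Downfold.Emery
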